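import Literature.NumberTheory.Transcendental.KZIntervalPeriodProofs
import Literature.NumberTheory.Transcendental.SemialgebraicLineDeriv
import Literature.NumberTheory.Transcendental.KZCubicalCalculus
import Literature.NumberTheory.Transcendental.SemialgebraicMapsProofs
import Mathlib.Analysis.Calculus.FDeriv.Comp
import Mathlib.Analysis.Calculus.Deriv.Comp
import Mathlib.Analysis.Calculus.Deriv.Pi
import Mathlib.Analysis.Calculus.Deriv.Mul
import Mathlib.Analysis.Calculus.Deriv.Prod
import Mathlib.Analysis.Convex.Basic

/-!
# `StokesGeneration` (stmt-KontsevichZagierPeriods-3586) — line `fibrewise_stokes`, stub `stub_isotopyTransport2` (auxiliary file)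

Auxiliary lemmas for the registered stub `stub_isotopyTransport2` (rung 2″ of the line
`fibrewise_stokes`, lead c4, wave 3): the two-dimensional transport certificate for a
face-preserving straight-line isotopy `Φᵤ = id + u V` of the square `[0,1]²`, realised by three
fibrewise Stokes elements on the cube `[0,1]³`.

This file collects the generic ingredients, all elementary:

* closure of the conjunction "`ℚ`-semialgebraic on `A` and continuous on `A`" under the ring
  operations, coordinates and algebraic constants, and under composition of a function on the
  square with a pair of such functions on the cube with values in the square (the semialgebraic
  half is Bochnak–Coste–Roy, Prop. 2.2.6, via the Tarski–Seidenberg theorem as discharged in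
  `Literature.NumberTheory.Transcendental.SemialgebraicMapsProofs`);
* the chain rule for a Fréchet-differentiable `f : ℝ² → ℝ` along a differentiable plane curve,
  written in the coordinates `f₀ = f'(e₀)`, `f₁ = f'(e₁)`;
* the three fibre derivatives of the primitives `G₀ = (f∘Φᵤ)·Jᵤ` (along `u`),
  `G₂ = −(f∘Φᵤ)·C₀` (along `x₀`) and `G₁ = −(f∘Φᵤ)·C₁` (along `x₁`), where
  `Jᵤ = det DΦᵤ` and `C = adj(DΦᵤ)·V` is the cofactor flux (product and chain rules only).

References: M. Kontsevich, D. Zagier, *Periods* (2001), §1.2, rule (2); J. Bochnak, M. Coste,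
M.-F. Roy, *Real Algebraic Geometry* (1998), Prop. 2.2.6.
-/

noncomputable section

-- `Summit.KontsevichZagierPeriods.KontsevichZagierPeriods.…` is the tree's mandated layout (single-conjunct summit).
set_option linter.dupNamespace false

namespace Summit.KontsevichZagierPeriods.KontsevichZagierPeriods.Cruxes.StokesGeneration.FibrewiseStokes

open MeasureTheory Set
open Literature.NumberTheory.Transcendental
open Literature.NumberTheory.Transcendental.KZ
open Literature.ModelTheory.ExponentialFields (IsSemialgebraic)

/-! ## Small facts about `Fin 3`, the interval and the square -/

/-- A property of the three elements of `Fin 3` holds for all of them. [folklore] -/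
theorem iso2_forall_fin_three {P : Fin 3 → Prop} (h0 : P 0) (h1 : P 1) (h2 : P 2) : ∀ j, P j := by
  intro j
  fin_cases j
  exacts [h0, h1, h2]

/-- If `a` and `a + v` lie in `[0,1]` and `t ∈ [0,1]`, then the point `a + t v` of the segment
between them lies in `[0,1]` (convexity of the interval). [folklore] -/
theorem iso2_combo_mem_Icc {a v t : ℝ} (ha : a ∈ Set.Icc (0:ℝ) 1) (hav : a + v ∈ Set.Icc (0:ℝ) 1)
    (ht : t ∈ Set.Icc (0:ℝ) 1) : a + t * v ∈ Set.Icc (0:ℝ) 1 := by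
  have h := convex_Icc (0:ℝ) 1 ha hav (sub_nonneg.2 ht.2) ht.1 (sub_add_cancel 1 t)
  have he : (1 - t) • a + t • (a + v) = a + t * v := by
    simp only [smul_eq_mul]
    ring
  exact he ▸ h

/-- Two points of `[0,1]` form a point of the square `[0,1]²`. [folklore] -/
theorem iso2_vec2_mem {a b : ℝ} (ha : a ∈ Set.Icc (0:ℝ) 1) (hb : b ∈ Set.Icc (0:ℝ) 1) :
    ![a, b] ∈ Set.pi Set.univ (fun _ : Fin 2 => Set.Icc (0:ℝ) 1) :=
  Set.mem_univ_pi.mpr (Fin.forall_fin_two.2 ⟨ha, hb⟩)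

/-- A derivative along the first coordinate line through the point `(a, b)` of the plane,
rewritten as a derivative of a function of the first coordinate (`update (a, b) 0 s = (s, b)`).
[folklore] -/
theorem iso2_fibre_zero {h : (Fin 2 → ℝ) → ℝ} {a b e : ℝ}
    (hd : HasDerivAt (fun s : ℝ => h (Function.update ![a, b] 0 s)) e (![a, b] 0)) :
    HasDerivAt (fun s : ℝ => h ![s, b]) e a := by
  have hu : ∀ s : ℝ, Function.update ![a, b] 0 s = ![s, b] := fun s => by
    funext i
    fin_cases i <;> simp
  simpa only [hu, Matrix.cons_val_zero] using hd

/-- A derivative along the second coordinate line through the point `(a, b)` of the plane,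
rewritten as a derivative of a function of the second coordinate (`update (a, b) 1 s = (a, s)`).
[folklore] -/
theorem iso2_fibre_one {h : (Fin 2 → ℝ) → ℝ} {a b e : ℝ}
    (hd : HasDerivAt (fun s : ℝ => h (Function.update ![a, b] 1 s)) e (![a, b] 1)) :
    HasDerivAt (fun s : ℝ => h ![a, s]) e b := by
  have hu : ∀ s : ℝ, Function.update ![a, b] 1 s = ![a, s] := fun s => by
    funext i
    fin_cases i <;> simp
  simpa only [hu, Matrix.cons_val_one, Matrix.cons_val_fin_one] using hd

/-! ## Semialgebraic-and-continuous functions -/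

section SC

variable {d : ℕ} {A : Set (Fin d → ℝ)} {g h : (Fin d → ℝ) → ℝ}

/-- Coordinates are `ℚ`-semialgebraic and continuous. [cite: BochnakCosteRoy1998, Prop. 2.2.6] -/
theorem iso2_sc_apply (hA : IsSemialgebraic ℚ A) (j : Fin d) :
    IsSemialgebraicFunOn ℚ A (fun x => x j) ∧ ContinuousOn (fun x => x j) A :=
  ⟨isSemialgebraicFunOn_apply hA j, (continuous_apply j).continuousOn⟩

/-- The constant `1` is `ℚ`-semialgebraic and continuous.
[cite: BochnakCosteRoy1998, Prop. 2.2.6] -/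
theorem iso2_sc_one (hA : IsSemialgebraic ℚ A) :
    IsSemialgebraicFunOn ℚ A (fun _ => (1:ℝ)) ∧ ContinuousOn (fun _ => (1:ℝ)) A :=
  ⟨isSemialgebraicFunOn_const_of_isAlgebraic hA isAlgebraic_one, continuousOn_const⟩

/-- Sums of `ℚ`-semialgebraic continuous functions are such.
[cite: BochnakCosteRoy1998, Prop. 2.2.6] -/
theorem iso2_sc_add (hg : IsSemialgebraicFunOn ℚ A g ∧ ContinuousOn g A)
    (hh : IsSemialgebraicFunOn ℚ A h ∧ ContinuousOn h A) :
    IsSemialgebraicFunOn ℚ A (fun x => g x + h x) ∧ ContinuousOn (fun x => g x + h x) A :=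
  ⟨hg.1.fun_add hh.1, hg.2.add hh.2⟩

/-- Differences of `ℚ`-semialgebraic continuous functions are such.
[cite: BochnakCosteRoy1998, Prop. 2.2.6] -/
theorem iso2_sc_sub (hg : IsSemialgebraicFunOn ℚ A g ∧ ContinuousOn g A)
    (hh : IsSemialgebraicFunOn ℚ A h ∧ ContinuousOn h A) :
    IsSemialgebraicFunOn ℚ A (fun x => g x - h x) ∧ ContinuousOn (fun x => g x - h x) A :=
  ⟨hg.1.fun_sub hh.1, hg.2.sub hh.2⟩

/-- Products of `ℚ`-semialgebraic continuous functions are such.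
[cite: BochnakCosteRoy1998, Prop. 2.2.6] -/
theorem iso2_sc_mul (hg : IsSemialgebraicFunOn ℚ A g ∧ ContinuousOn g A)
    (hh : IsSemialgebraicFunOn ℚ A h ∧ ContinuousOn h A) :
    IsSemialgebraicFunOn ℚ A (fun x => g x * h x) ∧ ContinuousOn (fun x => g x * h x) A :=
  ⟨hg.1.fun_mul hh.1, hg.2.mul hh.2⟩

/-- Negatives of `ℚ`-semialgebraic continuous functions are such.
[cite: BochnakCosteRoy1998, Prop. 2.2.6] -/
theorem iso2_sc_neg (hg : IsSemialgebraicFunOn ℚ A g ∧ ContinuousOn g A) :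
    IsSemialgebraicFunOn ℚ A (fun x => -g x) ∧ ContinuousOn (fun x => -g x) A :=
  ⟨hg.1.fun_neg, hg.2.neg⟩

end SC

/-- **Composition with a square-valued pair.** If `h` is `ℚ`-semialgebraic and continuous on the
square and `g₀, g₁` are `ℚ`-semialgebraic and continuous on the cube `[0,1]³` with
`(g₀ x, g₁ x) ∈ [0,1]²` for `x` in the cube, then `x ↦ h (g₀ x, g₁ x)` is `ℚ`-semialgebraic and
continuous on the cube: the map `x ↦ (g₀ x, g₁ x)` is a semialgebraic map of the cube into the
square, and composites of semialgebraic functions with semialgebraic maps are semialgebraic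
(Tarski–Seidenberg). [cite: BochnakCosteRoy1998, Prop. 2.2.6] -/
theorem iso2_sc_comp {h : (Fin 2 → ℝ) → ℝ} {g0 g1 : (Fin 3 → ℝ) → ℝ}
    (hh : IsSemialgebraicFunOn ℚ (Set.pi Set.univ (fun _ : Fin 2 => Set.Icc (0:ℝ) 1)) h ∧
      ContinuousOn h (Set.pi Set.univ (fun _ : Fin 2 => Set.Icc (0:ℝ) 1)))
    (hg0 : IsSemialgebraicFunOn ℚ (Set.pi Set.univ (fun _ : Fin 3 => Set.Icc (0:ℝ) 1)) g0 ∧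
      ContinuousOn g0 (Set.pi Set.univ (fun _ : Fin 3 => Set.Icc (0:ℝ) 1)))
    (hg1 : IsSemialgebraicFunOn ℚ (Set.pi Set.univ (fun _ : Fin 3 => Set.Icc (0:ℝ) 1)) g1 ∧
      ContinuousOn g1 (Set.pi Set.univ (fun _ : Fin 3 => Set.Icc (0:ℝ) 1)))
    (hmaps : ∀ x ∈ Set.pi Set.univ (fun _ : Fin 3 => Set.Icc (0:ℝ) 1),
      ![g0 x, g1 x] ∈ Set.pi Set.univ (fun _ : Fin 2 => Set.Icc (0:ℝ) 1)) :
    IsSemialgebraicFunOn ℚ (Set.pi Set.univ (fun _ : Fin 3 => Set.Icc (0:ℝ) 1))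
        (fun x => h ![g0 x, g1 x]) ∧
      ContinuousOn (fun x => h ![g0 x, g1 x])
        (Set.pi Set.univ (fun _ : Fin 3 => Set.Icc (0:ℝ) 1)) := by
  have hTsa : IsSemialgebraic ℚ (Set.pi Set.univ (fun _ : Fin 3 => Set.Icc (0:ℝ) 1)) := by
    rw [← cube_eq_pi]; exact isSemialgebraic_cube
  refine ⟨?_, hh.2.comp (hg0.2.matrixVecCons (hg1.2.matrixVecCons continuousOn_const)) hmaps⟩
  have hΨ : IsSemialgebraicMapOn ℚ (Set.pi Set.univ (fun _ : Fin 3 => Set.Icc (0:ℝ) 1))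
      (fun x => ![g0 x, g1 x]) :=
    IsSemialgebraicMapOn.of_forall hTsa
      (Fin.forall_fin_two.2 ⟨by simpa using hg0.1, by simpa using hg1.1⟩)
  exact IsSemialgebraicFunOn.comp_isSemialgebraicMapOn_holds hh.1 hΨ hmaps

/-! ## Calculus: the chain rule in coordinates and the three fibre derivatives -/

/-- A linear form on `ℝ²` evaluated through its values on the two coordinate vectors. [folklore] -/
theorem iso2_clm_apply (L : (Fin 2 → ℝ) →L[ℝ] ℝ) (w : Fin 2 → ℝ) :
    L w = L (Pi.single 0 1) * w 0 + L (Pi.single 1 1) * w 1 := by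
  have hw : w = w 0 • (Pi.single 0 1 : Fin 2 → ℝ) + w 1 • (Pi.single 1 1 : Fin 2 → ℝ) := by
    ext i
    fin_cases i <;> simp
  conv_lhs => rw [hw]
  rw [map_add, map_smul, map_smul, smul_eq_mul, smul_eq_mul]
  ring

/-- Velocity of a plane curve from the derivatives of its two coordinates. [folklore] -/
theorem iso2_hasDerivAt_vec2 {g0 g1 : ℝ → ℝ} {d0 d1 t : ℝ} (h0 : HasDerivAt g0 d0 t)
    (h1 : HasDerivAt g1 d1 t) : HasDerivAt (fun s => ![g0 s, g1 s]) ![d0, d1] t := by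
  refine hasDerivAt_pi.2 (Fin.forall_fin_two.2 ⟨?_, ?_⟩)
  · simpa using h0
  · simpa using h1

/-- **Chain rule in coordinates** (the registered auxiliary stub of this support file): if `f` has
Fréchet derivative `L` at the point `(g₀ t, g₁ t)` of a plane curve with coordinate derivatives
`d₀, d₁` at `t`, then `s ↦ f (g₀ s, g₁ s)` has derivative `L(e₀) d₀ + L(e₁) d₁` at `t`.
[folklore] -/
theorem iso2_hasDerivAt_comp :
    ∀ {f : (Fin 2 → ℝ) → ℝ} {L : (Fin 2 → ℝ) →L[ℝ] ℝ} {g0 g1 : ℝ → ℝ} {d0 d1 t : ℝ},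
      HasDerivAt g0 d0 t → HasDerivAt g1 d1 t → HasFDerivAt f L ![g0 t, g1 t] →
      HasDerivAt (fun s => f ![g0 s, g1 s])
        (L (Pi.single 0 1) * d0 + L (Pi.single 1 1) * d1) t := by
  intro f L g0 g1 d0 d1 t h0 h1 hf
  have h : HasDerivAt (fun s => f ![g0 s, g1 s]) (L ![d0, d1]) t :=
    hf.comp_hasDerivAt t (iso2_hasDerivAt_vec2 h0 h1)
  rw [iso2_clm_apply L] at h
  simpa using h

/-- **Fibre derivative along the isotopy parameter.** For the straight-line isotopy
`Φᵤ(a) = a + u v` and the Jacobian polynomial `Jᵤ = (1 + u w₀₀)(1 + u w₁₁) − u w₀₁ · u w₁₀`: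
`d/du [f(Φᵤ a) Jᵤ] = (f₀ v₀ + f₁ v₁)(Φᵤ a) Jᵤ + f(Φᵤ a) ∂ᵤJᵤ` (chain and product rules).
[folklore] -/
theorem iso2_hasDerivAt_dir2 {f : (Fin 2 → ℝ) → ℝ} {L : (Fin 2 → ℝ) →L[ℝ] ℝ}
    {a0 a1 v0 v1 s : ℝ} (w00 w01 w10 w11 : ℝ)
    (hf : HasFDerivAt f L ![a0 + s * v0, a1 + s * v1]) :
    HasDerivAt (fun u => f ![a0 + u * v0, a1 + u * v1] *
        ((1 + u * w00) * (1 + u * w11) - u * w01 * (u * w10)))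
      ((L (Pi.single 0 1) * v0 + L (Pi.single 1 1) * v1) *
          ((1 + s * w00) * (1 + s * w11) - s * w01 * (s * w10)) +
        f ![a0 + s * v0, a1 + s * v1] *
          (w00 * (1 + s * w11) + (1 + s * w00) * w11 - (w01 * (s * w10) + s * w01 * w10))) s := by
  have h0 : HasDerivAt (fun u => a0 + u * v0) (1 * v0) s :=
    ((hasDerivAt_id' s).mul_const v0).const_add a0
  have h1 : HasDerivAt (fun u => a1 + u * v1) (1 * v1) s :=
    ((hasDerivAt_id' s).mul_const v1).const_add a1
  have hF := iso2_hasDerivAt_comp h0 h1 hf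
  have hJ : HasDerivAt (fun u => (1 + u * w00) * (1 + u * w11) - u * w01 * (u * w10))
      (1 * w00 * (1 + s * w11) + (1 + s * w00) * (1 * w11) -
        (1 * w01 * (s * w10) + s * w01 * (1 * w10))) s :=
    ((((hasDerivAt_id' s).mul_const w00).const_add 1).fun_mul
      (((hasDerivAt_id' s).mul_const w11).const_add 1)).fun_sub
      (((hasDerivAt_id' s).mul_const w01).fun_mul ((hasDerivAt_id' s).mul_const w10))
  refine (hF.fun_mul hJ).congr_deriv ?_
  ring

/-- **Fibre derivative along the first coordinate.** With `u = c` and the second base coordinate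
`b` fixed, `v₀, v₁, w₀₁, w₁₁` the restrictions of `V₀, V₁, ∂₁V₀, ∂₁V₁` to the line `x₁ = b` and
`C₀ = (1 + c w₁₁) v₀ − c w₀₁ v₁` the first cofactor flux:
`d/ds [−f(Φ_c(s, b)) C₀(s)]` by the chain and product rules. [folklore] -/
theorem iso2_hasDerivAt_dir0 {f : (Fin 2 → ℝ) → ℝ} {L : (Fin 2 → ℝ) →L[ℝ] ℝ}
    {v0 v1 w01 w11 : ℝ → ℝ} {b c t dv0 dv1 dw01 dw11 : ℝ}
    (hv0 : HasDerivAt v0 dv0 t) (hv1 : HasDerivAt v1 dv1 t)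
    (hw01 : HasDerivAt w01 dw01 t) (hw11 : HasDerivAt w11 dw11 t)
    (hf : HasFDerivAt f L ![t + c * v0 t, b + c * v1 t]) :
    HasDerivAt (fun s => -(f ![s + c * v0 s, b + c * v1 s] *
        ((1 + c * w11 s) * v0 s - c * w01 s * v1 s)))
      (-((L (Pi.single 0 1) * (1 + c * dv0) + L (Pi.single 1 1) * (c * dv1)) *
            ((1 + c * w11 t) * v0 t - c * w01 t * v1 t) +
          f ![t + c * v0 t, b + c * v1 t] *
            (c * dw11 * v0 t + (1 + c * w11 t) * dv0 -
              (c * dw01 * v1 t + c * w01 t * dv1)))) t := by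
  have h0 : HasDerivAt (fun s => s + c * v0 s) (1 + c * dv0) t :=
    (hasDerivAt_id' t).fun_add (hv0.const_mul c)
  have h1 : HasDerivAt (fun s => b + c * v1 s) (c * dv1) t := (hv1.const_mul c).const_add b
  have hF := iso2_hasDerivAt_comp h0 h1 hf
  have hC : HasDerivAt (fun s => (1 + c * w11 s) * v0 s - c * w01 s * v1 s)
      (c * dw11 * v0 t + (1 + c * w11 t) * dv0 - (c * dw01 * v1 t + c * w01 t * dv1)) t :=
    (((hw11.const_mul c).const_add 1).fun_mul hv0).fun_sub ((hw01.const_mul c).fun_mul hv1)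
  refine ((hF.fun_mul hC).fun_neg).congr_deriv ?_
  ring

/-- **Fibre derivative along the second coordinate.** With `u = c` and the first base coordinate
`a` fixed, `v₀, v₁, w₀₀, w₁₀` the restrictions of `V₀, V₁, ∂₀V₀, ∂₀V₁` to the line `x₀ = a` and
`C₁ = (1 + c w₀₀) v₁ − c w₁₀ v₀` the second cofactor flux:
`d/ds [−f(Φ_c(a, s)) C₁(s)]` by the chain and product rules. [folklore] -/
theorem iso2_hasDerivAt_dir1 {f : (Fin 2 → ℝ) → ℝ} {L : (Fin 2 → ℝ) →L[ℝ] ℝ}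
    {v0 v1 w00 w10 : ℝ → ℝ} {a c t dv0 dv1 dw00 dw10 : ℝ}
    (hv0 : HasDerivAt v0 dv0 t) (hv1 : HasDerivAt v1 dv1 t)
    (hw00 : HasDerivAt w00 dw00 t) (hw10 : HasDerivAt w10 dw10 t)
    (hf : HasFDerivAt f L ![a + c * v0 t, t + c * v1 t]) :
    HasDerivAt (fun s => -(f ![a + c * v0 s, s + c * v1 s] *
        ((1 + c * w00 s) * v1 s - c * w10 s * v0 s)))
      (-((L (Pi.single 0 1) * (c * dv0) + L (Pi.single 1 1) * (1 + c * dv1)) *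
            ((1 + c * w00 t) * v1 t - c * w10 t * v0 t) +
          f ![a + c * v0 t, t + c * v1 t] *
            (c * dw00 * v1 t + (1 + c * w00 t) * dv1 -
              (c * dw10 * v0 t + c * w10 t * dv0)))) t := by
  have h0 : HasDerivAt (fun s => a + c * v0 s) (c * dv0) t := (hv0.const_mul c).const_add a
  have h1 : HasDerivAt (fun s => s + c * v1 s) (1 + c * dv1) t :=
    (hasDerivAt_id' t).fun_add (hv1.const_mul c)
  have hF := iso2_hasDerivAt_comp h0 h1 hf
  have hC : HasDerivAt (fun s => (1 + c * w00 s) * v1 s - c * w10 s * v0 s)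
      (c * dw00 * v1 t + (1 + c * w00 t) * dv1 - (c * dw10 * v0 t + c * w10 t * dv0)) t :=
    (((hw00.const_mul c).const_add 1).fun_mul hv1).fun_sub ((hw10.const_mul c).fun_mul hv0)
  refine ((hF.fun_mul hC).fun_neg).congr_deriv ?_
  ring

end Summit.KontsevichZagierPeriods.KontsevichZagierPeriods.Cruxes.StokesGeneration.FibrewiseStokes
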